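import Summits.QuantumFields.BalabanUV.T4Continuum.Support.B13AssemblyCoresEndSubstrateShiftMeasOp
import Summits.QuantumFields.BalabanUV.T4Continuum.Support.B13StepEndInsOpBalaban
import Summits.QuantumFields.BalabanUV.T4Continuum.Support.SubstrateO1ReadingsShiftRate

/-!
# B13AssemblyCoresEndSubstrateShiftBalabanRate — NE5 ∕ U3: THE END OF RECORD WITH (2.14) FACTOR CORES READ AT BAŁABAN's TIER-B BACKGROUND AT THE
# SUBSTRATE's LEVEL-SHIFTED O1 INSTANCE `SubstrateSlotsOfRecordShift.slotsOfRecordShift …` (W-21) ON THE MEASURABLE OPERATOR CARRIER OF RECORD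
# `measOp`, **ON THE RATE ROAD** — W1 supplied by substrate-p1's L-E9c `SubstrateO1ReadingsShiftRate` (p239614) BY NAME: row NE2's per-background
# two-level-consistency binder `LocalRate` of the coefficient towers and an abstract potential-readings carrier, **NO row NE3 input** (NE5 owner
# RULING R58, `HOME/CLAIMS.log` l.22206; substrate-typer (ο7-2) ∕ (ο9-1); owner g38-c `B13ReadingsRecordRate` p239282) — the `_rate` twin of this
# lineage's `B13AssemblyCoresEndSubstrateShiftBalaban` (S2a, p237335); the arithmetic letters ELIMINATED (this lineage's
# `B13AssemblyCoresEndSubstrateShiftMeasOp` §2) BY NAME; per two-run object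

Cell `pub-balaban`, unit `b2b-balaban-t4-ne5-formalise-leaf-08` (NE5 formalisation swarm, LEAF PROVER 08, gen 17; the (2.14)-CORES ROAD lineage;
typer `t4/formal/NE5/LEAVES.md` CLAIM RULE 7 (b)(e) ∕ CLAIM RULE 1: a landed END face APPLIED BY NAME at the substrate's O1 instance in a NEW
`Support/B13*` module, re-pointing twins by the AUTHOR lineage; journal INTENT `HOME/CLAIMS.log` l.22637).  WHY THE RE-POINT (owner R58; a ruling
on the row's dependency set, nothing of print asserted here): S2a (p237335) PRODUCES W1 from L-E9b `SubstrateO1ReadingsShift`, whose two-level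
consistency letter is node NE3's `NE3Shape (minActReadings d 𝒞 L N dom (ne2Loc …)) Cn θ` — a statement about the two runs' MINIMISERS.  R58: the real
window of record of Road D is the window of AVERAGING TOWERS of free (α′,β′)-regular real fine fields ([Balaban1988RG2Cluster] p. 7, KIND: the
inserted terms are analytic on `U^c_{k+1}(Y, (1+2β)α₀, (1+2β)α₁)`), and for such towers two-level consistency is REGULARITY — row NE2's bridge
`NE2FromNE3BavgBridge.localRate_regClass_of_bavg_consistent` discharges the per-background binder `LocalRate (bgReadings L M (regClass L M (liftR L M
(RgV V)))) Cn θ` that `B13ReadingsDecay.balaban_twoLevelDecayRate_rate` consumes — so node NE3 does NOT enter NE5's W1.  The owner's g38-c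
`B13ReadingsRecordRate` re-packaged the W1 record face on that RATE ROAD (binders `hθ0`∕`hθ1`∕`hloc`∕`{Rp} hRp` in place of `hNE3`; conclusions
identical in shape), substrate-p1's W-21c `SubstrateO1ReadingsShiftRate` applied it ONCE at `slotsOfRecordShift` (the W-21b pattern, «added BESIDE
W-21b, never edited in», (ο7-2)), and THIS module is S2a re-pointed accordingly: the SAME composition with W1 `hwer` := W-21c's
`weightedEntrywiseRate_slotsOfRecordShift_balaban_rate`, the binder `hNE3 : NE3Shape (minActReadings …) Cn θ` REPLACED by `(hθ0 : 0 ≤ θ) (hθ1 : θ < 1)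
(hloc : ∀ V ∈ dom, LocalRate (bgReadings L M (regClass L M (liftR L M (RgV V)))) Cn θ) {Rp : Readings ιp Xp} (hRp : LocalRate Rp Cn θ)`, the datum
type `BgD` of `dom` FREED (no minimal action is read: `dom` may be the regular real fine fields themselves), `hQ`∕`hR` reading `Rp`,
`sqrt_rate_pos_lt_one … hNE3.rate_lt_one ↦ sqrt_rate_pos_lt_one … hθ1` — EVERY OTHER BYTE of statement and proof VERBATIM (generator
`HOME/t4/b2b-balaban-t4-ne5-formalise-leaf-08/g17/tools/gen_rate.py`, 15 counted substitutions).  The cov readings stay WINDOWED to `{k | k ≤ D.K}`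
(`B13ReadingsLevelWindow.ReadsTowerCovAOn ∕ ReadsTowerCovBOn`, owner R55), the off-window agreement discharged INSIDE W-21c (`covAtOfRecord_of_lt` ×2).
Imports this lineage's `B13AssemblyCoresEndSubstrateShiftMeasOp`, leaf-10-g8's `B13StepEndInsOpBalaban` (for `sqrt_rate_pos_lt_one` ∕
`c1_balaban_nonneg` BY NAME) and substrate-p1's `SubstrateO1ReadingsShiftRate` ONLY; edits nothing (S2a ∕ S2b, S1 ∕ S1b, N184 ∕ N191 ∕ p229718 ∕
p229762 and W-21b STAY AS LANDED — true roads, append-only; after R58 the `…_ne3Shape` packaging is a consumed face, not the W1 of record); defines NO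
species reading (owner RULING R41) and constructs ∕ discharges NOTHING of the instance (DESIGN RULE R34) beyond the by-name readings listed below.
Summits-side new work under the LEAN PLACEMENT RULE (bookkeeping; 0 `def`, 0 cite tags — printed KIND only).  HONEST FRAMING: rung (B)+1 of the
FINITE-VOLUME T⁴ continuum programme — NOT infinite volume, NOT a mass gap, NOT the Clay problem, and **NOT A PROOF OF NE5** (NOT PRINTED: the
series prints ε-UNIFORM bounds, never η-RATES; cell GAPS G-t4-U3-1), NOT a proof of NE2: every theorem is an IMPLICATION whose wall binders are
DISPLAYED HYPOTHESES — ABOUT THE SUBSTRATE's LETTERS (`SlotLetters`), the substrate's (2.14)-cores of record `coresRec`, and row NE2's two rates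
`hloc`∕`hRp` — asserted nowhere; the substrate's instance is NOT claimed to satisfy any of them.  R48 ∕ R49 HONEST LINE: the slots of record are the
VALUE-TABLE model (poorer than print at MI-R, [Balaban1988RG2Cluster] Lemma 1 (1.33)); Road D `OutputRateFunctionalTables*` is of record for MI-R,
instance = substrate; VALUE UNCHANGED.  O-8-vol (R54 (3)): the block torus at every depth is the final unit torus; printed bounds consumed are
volume-uniform; no identification of objects across volumes is claimed.  HONEST DEPENDENCY (cell line, verbatim): continuum YM on T⁴ ⇐ BetaPertH ∧
nine spine estimates (0/9 proved); BetaPertH ⇐ (D1) ∧ (D4) ∧ CAP+tail; G-an2-4 gates asym, D1 and NE2/3/4.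

WHAT THIS FILE DOES (compositions BY NAME; no analytic estimate of its own).  At `S₀ := slotsOfRecordShift D ιr cc ag sg Pm 𝒵 domZ Jc Vv mI Lsl` two
binders of this lineage's letters-free cores END on `measOp`, `B13AssemblyCoresEndSubstrateShiftMeasOp.exists_ne5_substrateShift_cores_actNorm`, are
READ BY NAME: (i) W1 `hwer` := substrate-p1's `SubstrateO1ReadingsShiftRate.weightedEntrywiseRate_slotsOfRecordShift_balaban_rate` (the owner's
rate-road record face AT the shifted instance, slot lines `rfl`) — so the honest rate `0 ≤ θ < 1`, row NE2's per-background binder `hloc : ∀ V ∈ dom,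
LocalRate (bgReadings L M (regClass L M (liftR L M (RgV V)))) Cn θ` (OPEN, row NE2; for averaging towers of regular fields = NE2's bridge BY NAME), the
abstract potential-readings carrier `{Rp : Readings ιp Xp} (hRp : LocalRate Rp Cn θ)` (OPEN), the (3.35)-class ∕ threshold letters and the owner's O1
reading ∕ decay ∕ Lipschitz ∕ domination letters AT THE SUBSTRATE's SHIFTED TABLES are displayed instead, input rate `Θ := √(max θ L⁻¹)` — the cov
readings `hcovA ∧ hcovB` jointly inhabited by the substrate's own one-datum tower (W-21 §3), the W1-cov difference being row NE2's TWO-LEVEL rate on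
averaging towers (R58 (M1-real⁺)) — DISPLAYED, asserted by nobody here; (ii) `hc₁ ∕ hθ0′ ∕ hθ1′` := p225077 §1 (`c1_balaban_nonneg`,
`sqrt_rate_pos_lt_one … hθ1`).  W4 is displayed AT `Θ`; EVERY OTHER binder of `…ShiftMeasOp` §2 is displayed VERBATIM (p221190's six letter
conditions at the shifted slots `hbdA … hmRB` and factorisation datum `(iopAt, hiopA)`; W3 slice budgets ×2; L05∕L06 of the instance's outputs;
`RawBounded` ×2 + floor; rooms; the FACTOR operator letters of the substrate's cores `coresRec` on the `measOp`-balls about run B's SHIFTED datum of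
record; the history radius; the stripped majorant `A′` with its decay split and the anchored exponential norm `Φ′ < 1∕36`; sizes; the TWO STRICT SIZE
INEQUALITIES — they contain neither W1's constant nor the input rate).
* §1 **`exists_ne5_of_substrateShift_cores_balaban_rate`** — PER TWO-RUN OBJECT `D : DrivenRuns G` and letter package `Lsl`: conclusion LITERALLY
  `∃ C₅, T4OutputRate.NE5 (B13StepOfRecord.outA (slotsOfRecordShift …) E₀ cB) (B13StepOfRecord.outB (slotsOfRecordShift …) E₀ cB) W κ θ′ C₅` at the
  PRESCRIBED `θ′` (the SAME `θ′` as S2a).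
CENSUS vs S2a p237335 §1 (named binders of the theorem, `g17/tools/binder_census.py`): 120 → 122; MINUS = {`𝒞`, `N`, `hNE3`}; PLUS = {`hθ0`, `hθ1`,
`hloc`, `Rp`, `hRp`} (+ the section's new implicit type variables `BgD ιp Xp`); CHANGED in type only: `dom`, `RgV` (datum type `BgD`), `hQ`, `hR`
(readings carrier `Rp`).  Headline wording (trigger c5 ∕ referee INFO-38): «END ⇐ instance letters»,
never «leaf instantiated»; 0∕12 leaves on Bałaban's concrete objects; spine 0∕9.  `FlowStep.BetaPertH`, (B), (B^μ) do not occur.  0 sorry; axioms ⊆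
{propext, Classical.choice, Quot.sound}.
-/

noncomputable section

open scoped BigOperators Matrix.Norms.L2Operator
open Metric Set

namespace Summit.QuantumFields.BalabanUV.T4Continuum.B13AssemblyCoresEndSubstrateShiftBalabanRate

open _root_.MeasureTheory
open Literature.MathematicalPhysics.QuantumFieldTheory.Balaban1983to89
open Literature.MathematicalPhysics.QuantumFieldTheory.Balaban1983to89.T4OutputRate (DecayBound NE5)
open Literature.MathematicalPhysics.QuantumFieldTheory.Balaban1983to89.B5Prop11Plancherel (Tor fine)
open Literature.MathematicalPhysics.QuantumFieldTheory.Balaban1983to89.B5G183RateUnitTower (lev lev_neZero)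
open Literature.MathematicalPhysics.QuantumFieldTheory.Balaban1983to89.T4EtaRateMin (Readings LocalRate)
open Summit.QuantumFields.BalabanUV.T4Continuum
open Summit.QuantumFields.BalabanUV.T4Continuum.B13OpDatum
open Summit.QuantumFields.BalabanUV.T4Continuum.B13OpDatumJunctions (opOf RawBounded WeightedEntrywiseRate)
open Summit.QuantumFields.BalabanUV.T4Continuum.B13OpMeasurable (measOp)
open Summit.QuantumFields.BalabanUV.T4Continuum.B13StepTermLabels (InnerLabel)
open Summit.QuantumFields.BalabanUV.T4Continuum.B13InnerData (Bnd b13InnerData)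
open Summit.QuantumFields.BalabanUV.T4Continuum.B13HistMeasurable (MeasPotFrame B13HistM)
open Summit.QuantumFields.BalabanUV.T4Continuum.B13TermCoreFamily (factorCores)
open Summit.QuantumFields.BalabanUV.T4Continuum.B13TermCoreMass (factorMass)
open Summit.QuantumFields.BalabanUV.T4Continuum.UrsellTreeSum (ind)
open Summit.QuantumFields.BalabanUV.T4Continuum.UrsellTermBudget (actSum)
open Summit.QuantumFields.BalabanUV.T4Continuum.B13DomainGeometryTR (SCube footprint)
open Summit.QuantumFields.BalabanUV.T4Continuum.B13StepOfRecord (assembly step outA outB)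
open Summit.QuantumFields.BalabanUV.T4Continuum.B13AssemblyCoresEndRestrictRecord (coresRec)
open Summit.QuantumFields.BalabanUV.T4Continuum.B13AssemblyCoresEndSubstrateShiftMeasOp (ne5_substrateShift_cores_actNorm exists_ne5_substrateShift_cores_actNorm)
open Summit.QuantumFields.BalabanUV.T4Continuum.B13StepOfRecordSubstrateShiftLetters (opB_mem_measOp_slotsOfRecordShift)
open Summit.QuantumFields.BalabanUV.T4Continuum.B13StepEndArithmetic (reach_elim_iff smallness_of_gain)
open Summit.QuantumFields.BalabanUV.T4Continuum.OutputRateArithmetic (reach_binders_exists)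
open Summit.QuantumFields.BalabanUV.T4Continuum.B13StepEndInsOpBalaban (sqrt_rate_pos_lt_one c1_balaban_nonneg)
open Summit.QuantumFields.BalabanUV.T4Continuum.B13ReadingsDecay (CovWeightDominatesDist)
open Summit.QuantumFields.BalabanUV.T4Continuum.B13ReadingsLevelWindow (ReadsTowerCovAOn ReadsTowerCovBOn)
open Summit.QuantumFields.BalabanUV.T4Continuum.B13ReadingsImage
open Summit.QuantumFields.BalabanUV.T4Continuum.B13ReadingsLocal (PotQLipschitzReading PotRLipschitzReading)
open Summit.QuantumFields.BalabanUV.T4Continuum.B13ReadingsAssembly (CpertRec)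
open Summit.QuantumFields.BalabanUV.T4Continuum.SubstrateO1ReadingsShiftRate (weightedEntrywiseRate_slotsOfRecordShift_balaban_rate)
open Summit.QuantumFields.BalabanUV.T4Continuum.DecayRateInterpolation (EntryDecay)
open Summit.QuantumFields.BalabanUV.T4Continuum.SubstrateBackgroundTransporters (unitMod)
open Summit.QuantumFields.BalabanUV.T4Continuum.SubstrateTwoRunsDriven (DrivenRuns)
open Summit.QuantumFields.BalabanUV.T4Continuum.SubstrateRawSpecies
open Summit.QuantumFields.BalabanUV.T4Continuum.SubstrateSlotsOfRecord
open Summit.QuantumFields.BalabanUV.T4Continuum.SubstrateSlotsOfRecordShift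
open Summit.QuantumFields.BalabanUV.T4Continuum.BalabanAveragedTowerUnit (idx)
open Summit.QuantumFields.BalabanUV.T4Continuum.GaugeTermScalarData (QuT Q1)
open Summit.QuantumFields.BalabanUV.T4Continuum.RegularSiteTransporters (siteT)
open Summit.QuantumFields.BalabanUV.T4Continuum.RegularBackgroundTower (RegularTransporters regClass)
open Summit.QuantumFields.BalabanUV.T4Continuum.NE2FromNE3 (bgReadings)
open Summit.QuantumFields.BalabanUV.T4Continuum.NE2ColourPerturbedLayer (pertCovC)
open Summit.QuantumFields.BalabanUV.T4Continuum.NE2BalabanRoot (balabanPert)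
open Summit.QuantumFields.BalabanUV.T4Continuum.NE2BalabanGauge (gaugeSlot liftR)
open Summit.QuantumFields.BalabanUV.T4Continuum.NE2BalabanThreshold (etaStar)

/-! ## §1 The cores END of record at Bałaban's tier-B background, STATED AT THE SUBSTRATE's O1 INSTANCE on `measOp` -/

section Instance

-- the substrate's telescope for `slotsOfRecordShift` (W-21 over p220104 §SlotsRecord; letter names as in `SubstrateO1ReadingsShift`)
variable {𝔾 : Type} [GaugeGroup 𝔾] (D : DrivenRuns 𝔾)
variable {oc : Type} [Fintype oc] [DecidableEq oc] (ιr : 𝔾 →* Matrix oc oc ℂ) (cc : ℂ) (ag : ℝ) (sg : ℕ → ℂ)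
variable {T ι' Sy Ω 𝒴 : Type} [MeasurableSpace Ω] (Pm : MeasPotFrame D.carriers) {IOp : Type*}
  (𝒵 : D.carriers.Dom → InnerLabel D.carriers.Dom (Bnd D.toTwoRuns) → Type) [∀ Z j, Fintype (𝒵 Z j)] (domZ : ∀ Z j, 𝒵 Z j → D.carriers.Dom)
  (Jc : D.carriers.Dom → InnerLabel D.carriers.Dom (Bnd D.toTwoRuns) → Type) [∀ Z j, Fintype (Jc Z j)]
  (Vv : D.carriers.Dom → InnerLabel D.carriers.Dom (Bnd D.toTwoRuns) → Type) [∀ Z j, NormedAddCommGroup (Vv Z j)]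
  [∀ Z j, InnerProductSpace ℝ (Vv Z j)] [∀ Z j, MeasurableSpace (Vv Z j)] [∀ Z j, BorelSpace (Vv Z j)] [∀ Z j, FiniteDimensional ℝ (Vv Z j)]
  (mI : D.carriers.Dom → InnerLabel D.carriers.Dom (Bnd D.toTwoRuns) → Type) [∀ Z j, Fintype (mI Z j)] [∀ Z j, DecidableEq (mI Z j)]
  (Lsl : SlotLetters D (o := oc) (T := T) (ι' := ι') (S := Sy) (Ω := Ω) (𝒴 := 𝒴) Pm (IOp := IOp) 𝒵 domZ Jc Vv mI)
-- node NE3 ∕ the owner's letters (sizes)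
variable {d : ℕ} (L : ℕ) [NeZero L] (M : Fin d → ℕ) [hM : ∀ μ, NeZero (M μ)] (a : ℝ) (ha : 0 < a)
variable {o : Type*} [Fintype o] [DecidableEq o] {α β C a' η : ℝ} {m : Type*} [Fintype m] [DecidableEq m] {BgD ιp Xp : Type*}

/-- [folklore] **THE END OF RECORD WITH (2.14) FACTOR CORES, W1 PRODUCED AT BAŁABAN's TIER-B BACKGROUND ON THE RATE ROAD, ARITHMETIC
LETTERS ELIMINATED — AT THE SUBSTRATE's LEVEL-SHIFTED O1 INSTANCE ON `measOp`** `S₀ := slotsOfRecordShift D ιr cc ag sg Pm 𝒵 domZ Jc Vv mI Lsl`: this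
lineage's `B13AssemblyCoresEndSubstrateShiftMeasOp.exists_ne5_substrateShift_cores_actNorm` (N191 §2 at the shifted slots) with `hwer` SUPPLIED BY NAME by
substrate-p1's W-21c `weightedEntrywiseRate_slotsOfRecordShift_balaban_rate` (the honest rate `hθ0 ∕ hθ1`, row NE2's per-background two-level
consistency `hloc` (OPEN, row NE2), the potential readings' carrier and rate `{Rp} hRp` (OPEN), the class ∕ threshold letters `hreg hα hβ hC ha' hαη hβη
hη` and the owner's O1 letters AT THE SUBSTRATE's TABLES `hdec … hR` displayed; NO row NE3 input — owner R58; run A read THROUGH THE TRANSPORTER),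
`hc₁ ∕ hθ0′ ∕ hθ1′` discharged (p225077 §1 at `hθ1`), W4 displayed at the input rate `√(max θ L⁻¹)`; p221190's letter conditions `hbdA … hmRB` and
factorisation datum `(iopAt, hiopA)`, margins and age damping read off the letters (`Lsl.rOp`, `Lsl.rHist`, `Lsl.ins.ω`); EVERY OTHER binder of
`…ShiftMeasOp` §2 (= p222947 §2 at the shifted slots) VERBATIM; the cov readings `hcovA ∕ hcovB` are the WINDOWED shapes `ReadsTowerCov{A,B}On {k | k ≤
D.K}`.  Conclusion LITERALLY `∃ C₅, T4OutputRate.NE5 (B13StepOfRecord.outA (slotsOfRecordShift …) E₀ cB) (B13StepOfRecord.outB (slotsOfRecordShift …) E₀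
cB) W κ θ′ C₅` at the PRESCRIBED `θ′` — S2a's (p237335) with the W1 letter block re-pointed, nothing else.  NOT a proof of NE5 ∕ NE2: an implication
from displayed binders about the substrate's letters and row NE2's rates; nothing of Bałaban's is asserted. -/
theorem exists_ne5_of_substrateShift_cores_balaban_rate
    -- p221190 §1's letter conditions at the SHIFTED slots (the `measOp` memberships, via `B13StepOfRecordSubstrateShiftLetters`) and §2's factorisation datum (L01)
    (hbdA : ∀ (g : ℕ → ℝ) (U : D.carriers.BgA) (k : ℕ),
      FormatBounded (Lsl.W k).format (rawAOfRecord ιr D cc ag sg Lsl.ΓA Lsl.dkA Lsl.gcA Lsl.pQA Lsl.pRA g U k).kernel)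
    (hmQA : ∀ (r : ℝ) (U : GaugeField (D.F.P D.K) 0 𝔾) (k : ℕ) (Y : 𝒴) (b b' : ((Tor (unitMod (D.F.P D.K)) × Fin (D.F.P D.K).d) × oc)),
      Measurable fun x : Ω => Lsl.pQA r U k x Y b b')
    (hmRA : ∀ (r : ℝ) (U : GaugeField (D.F.P D.K) 0 𝔾) (k : ℕ) (Y : 𝒴), Measurable fun x : Ω => Lsl.pRA r U k x Y)
    (hbdB : ∀ (g : ℕ → ℝ) (U : D.carriers.BgB) (k : ℕ),
      FormatBounded (Lsl.W k).format (rawBOfRecordShift D ιr cc ag sg Lsl.ΓB Lsl.dkB Lsl.gcB Lsl.pQB Lsl.pRB g U k).kernel)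
    (hmQB : ∀ (r : ℝ) (U : GaugeField (D.F.P (D.K + 1)) 0 𝔾) (k : ℕ) (Y : 𝒴) (b b' : ((Tor (unitMod (D.F.P D.K)) × Fin (D.F.P D.K).d) × oc)),
      Measurable fun x : Ω => Lsl.pQB r U k x Y b b')
    (hmRB : ∀ (r : ℝ) (U : GaugeField (D.F.P (D.K + 1)) 0 𝔾) (k : ℕ) (Y : 𝒴), Measurable fun x : Ω => Lsl.pRB r U k x Y)
    (iopAt : ℝ → D.carriers.BgA → ℕ → IOp)
    (hiopA : ∀ (r : ℝ) (U : D.carriers.BgB) (k : ℕ), Lsl.ins.iopA r U k = iopAt r (D.carriers.transport U) k) (E₀ cB : ℝ)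
    -- the (3.35)-class, the honest rate, row NE2's per-background two-level consistency of the coefficient towers (its ROOT-B binder; for
    -- averaging towers of regular fields = NE2's bridge `NE2FromNE3BavgBridge.localRate_regClass_of_bavg_consistent`), the abstract
    -- potential-readings carrier with its rate, the threshold — NO row NE3 input (owner R58); the datum type `BgD` of `dom` is free
    {dom : Set BgD} (hL : 2 ≤ L) (hd : 1 ≤ d)
    {RgV : BgD → ((k : ℕ) → Fin d → (Tor (fine (lev L k) M) → Matrix o o ℂ))}
    (hreg : ∀ V ∈ dom, RegularTransporters L M (liftR L M (RgV V)) α β) (hα : 0 ≤ α) (hβ : 0 ≤ β) (hC : 0 ≤ C) {θ : ℝ}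
    (hθ0 : 0 ≤ θ) (hθ1 : θ < 1) (hloc : ∀ V ∈ dom, LocalRate (bgReadings L M (regClass L M (liftR L M (RgV V)))) C θ)
    {Rp : Readings ιp Xp} (hRp : LocalRate Rp C θ)
    (ha' : 0 < a') (hαη : α ≤ η) (hβη : β ≤ η) (hη : η ≤ etaStar o d a a')
    -- the towers over the two-run object's run-B backgrounds and the window
    {tow : ℕ → (ℕ → ℝ) → D.toTwoRuns.carriers.BgB → ↥dom} {W : Set (ℕ → ℝ)}
    -- the covariance species, read at the substrate's V1 operator entries
    {σ : T → ((Tor (unitMod (D.F.P D.K)) × Fin (D.F.P D.K).d) × oc) → idx L M 0 × o} {dist₁ : idx L M 0 × o → idx L M 0 × o → ℝ} {B₁ δ₁ : ℝ}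
    (hdec : ∀ V ∈ dom, ∀ k, EntryDecay dist₁
      (pertCovC L M a ha (balabanPert L M a (liftR L M (RgV V)) (gaugeSlot L M (RgV V) (QuT L M o (siteT L M (RgV V))) (Q1 L M o) a'))
        1 k) B₁ δ₁)
    (hcovA : ReadsTowerCovAOn {k : ℕ | k ≤ D.K}
      (fun V : ↥dom => pertCovC L M a ha
        (balabanPert L M a (liftR L M (RgV V)) (gaugeSlot L M (RgV V) (QuT L M o (siteT L M (RgV V))) (Q1 L M o) a')) 1)
      σ tow (fun g U k => (rawAOfRecord ιr D cc ag sg Lsl.ΓA Lsl.dkA Lsl.gcA Lsl.pQA Lsl.pRA) g (D.toTwoRuns.carriers.transport U) k) W)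
    (hcovB : ReadsTowerCovBOn {k : ℕ | k ≤ D.K}
      (fun V : ↥dom => pertCovC L M a ha
        (balabanPert L M a (liftR L M (RgV V)) (gaugeSlot L M (RgV V) (QuT L M o (siteT L M (RgV V))) (Q1 L M o) a')) 1)
      σ tow (rawBOfRecordShift D ιr cc ag sg Lsl.ΓB Lsl.dkB Lsl.gcB Lsl.pQB Lsl.pRB) W)
    (hdom₁ : CovWeightDominatesDist (slotsOfRecordShift D ιr cc ag sg Pm 𝒵 domZ Jc Vv mI Lsl).F dist₁ σ (δ₁ / 2))
    -- the `deltaKer` species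
    {S₂ : Set (Matrix (idx L M 0 × o) (idx L M 0 × o) ℂ)} {Φ : T → Matrix (idx L M 0 × o) (idx L M 0 × o) ℂ → Matrix m m ℂ}
    {Λ₂ : ℝ} (hΦ : ∀ t, OpLipschitzOn S₂ (Φ t) Λ₂) (hΛ₂ : 0 ≤ Λ₂)
    (hS₂ : ∀ V ∈ dom, ∀ k, pertCovC L M a ha
      (balabanPert L M a (liftR L M (RgV V)) (gaugeSlot L M (RgV V) (QuT L M o (siteT L M (RgV V))) (Q1 L M o) a')) 1 k ∈ S₂)
    {dist₂ : m → m → ℝ} {B₂ δ₂ : ℝ}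
    (hdecΦ : ∀ V ∈ dom, ∀ t k, EntryDecay dist₂ (Φ t (pertCovC L M a ha
      (balabanPert L M a (liftR L M (RgV V)) (gaugeSlot L M (RgV V) (QuT L M o (siteT L M (RgV V))) (Q1 L M o) a')) 1 k)) B₂ δ₂)
    {σX : T → ι' → m}
    (hΔA : ReadsTowerDeltaA (fun (V : ↥dom) t k => Φ t (pertCovC L M a ha
      (balabanPert L M a (liftR L M (RgV V)) (gaugeSlot L M (RgV V) (QuT L M o (siteT L M (RgV V))) (Q1 L M o) a')) 1 k))
      σX tow (fun g U k => (rawAOfRecord ιr D cc ag sg Lsl.ΓA Lsl.dkA Lsl.gcA Lsl.pQA Lsl.pRA) g (D.toTwoRuns.carriers.transport U) k) W)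
    (hΔB : ReadsTowerDeltaB (fun (V : ↥dom) t k => Φ t (pertCovC L M a ha
      (balabanPert L M a (liftR L M (RgV V)) (gaugeSlot L M (RgV V) (QuT L M o (siteT L M (RgV V))) (Q1 L M o) a')) 1 k))
      σX tow (rawBOfRecordShift D ιr cc ag sg Lsl.ΓB Lsl.dkB Lsl.gcB Lsl.pQB Lsl.pRB) W)
    (hdom₂ : DeltaWeightDominatesDist (slotsOfRecordShift D ιr cc ag sg Pm 𝒵 domZ Jc Vv mI Lsl).F dist₂ σX (δ₂ / 2))
    -- the `gammaConstituent` species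
    {S₃ : Set (Matrix (idx L M 0 × o) (idx L M 0 × o) ℂ)} {Ψ : T → Matrix (idx L M 0 × o) (idx L M 0 × o) ℂ → Matrix m m ℂ}
    {Λ₃ : ℝ} (hΨ : ∀ t, OpLipschitzOn S₃ (Ψ t) Λ₃) (hΛ₃ : 0 ≤ Λ₃)
    (hS₃ : ∀ V ∈ dom, ∀ k, pertCovC L M a ha
      (balabanPert L M a (liftR L M (RgV V)) (gaugeSlot L M (RgV V) (QuT L M o (siteT L M (RgV V))) (Q1 L M o) a')) 1 k ∈ S₃)
    {dist₃ : m → m → ℝ} {B₃ δ₃ : ℝ}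
    (hdecΨ : ∀ V ∈ dom, ∀ t k, EntryDecay dist₃ (Ψ t (pertCovC L M a ha
      (balabanPert L M a (liftR L M (RgV V)) (gaugeSlot L M (RgV V) (QuT L M o (siteT L M (RgV V))) (Q1 L M o) a')) 1 k)) B₃ δ₃)
    {σB : T → ((Tor (unitMod (D.F.P D.K)) × Fin (D.F.P D.K).d) × oc) → m}
    (hΓA : ReadsTowerGammaA (fun (V : ↥dom) t k => Ψ t (pertCovC L M a ha
      (balabanPert L M a (liftR L M (RgV V)) (gaugeSlot L M (RgV V) (QuT L M o (siteT L M (RgV V))) (Q1 L M o) a')) 1 k))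
      σB σX tow (fun g U k => (rawAOfRecord ιr D cc ag sg Lsl.ΓA Lsl.dkA Lsl.gcA Lsl.pQA Lsl.pRA) g (D.toTwoRuns.carriers.transport U) k) W)
    (hΓB : ReadsTowerGammaB (fun (V : ↥dom) t k => Ψ t (pertCovC L M a ha
      (balabanPert L M a (liftR L M (RgV V)) (gaugeSlot L M (RgV V) (QuT L M o (siteT L M (RgV V))) (Q1 L M o) a')) 1 k))
      σB σX tow (rawBOfRecordShift D ιr cc ag sg Lsl.ΓB Lsl.dkB Lsl.gcB Lsl.pQB Lsl.pRB) W)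
    (hdom₃ : GammaWeightDominatesDist (slotsOfRecordShift D ιr cc ag sg Pm 𝒵 domZ Jc Vv mI Lsl).F dist₃ σB σX (δ₃ / 2))
    -- the potential species
    {Λ₄ Λ₅ : ℝ} (hΛ₄ : 0 ≤ Λ₄) (hΛ₅ : 0 ≤ Λ₅)
    (hQ : PotQLipschitzReading Rp (slotsOfRecordShift D ιr cc ag sg Pm 𝒵 domZ Jc Vv mI Lsl).F
      (fun g U k => (rawAOfRecord ιr D cc ag sg Lsl.ΓA Lsl.dkA Lsl.gcA Lsl.pQA Lsl.pRA) g (D.toTwoRuns.carriers.transport U) k)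
      (rawBOfRecordShift D ιr cc ag sg Lsl.ΓB Lsl.dkB Lsl.gcB Lsl.pQB Lsl.pRB) W Λ₄)
    (hR : PotRLipschitzReading Rp (slotsOfRecordShift D ιr cc ag sg Pm 𝒵 domZ Jc Vv mI Lsl).F
      (fun g U k => (rawAOfRecord ιr D cc ag sg Lsl.ΓA Lsl.dkA Lsl.gcA Lsl.pQA Lsl.pRA) g (D.toTwoRuns.carriers.transport U) k)
      (rawBOfRecordShift D ιr cc ag sg Lsl.ΓB Lsl.dkB Lsl.gcB Lsl.pQB Lsl.pRB) W Λ₅)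
    -- the rest of `…ShiftMeasOp` §2 (p222947 §2 at the shifted slots) VERBATIM at the instance (W4 at the input rate; the factor-mass decay split renamed `hdecM`)
    {ROp RHist R' H : ℕ → ℝ} {N₀f mf bf : D.carriers.Dom → InnerLabel D.carriers.Dom (Bnd D.toTwoRuns) → ℝ}
    {A' : ℕ → D.carriers.Dom → InnerLabel D.carriers.Dom (Bnd D.toTwoRuns) → ℝ} {mstar κ Φ' EA₀ cA r₀ δ' θ' : ℝ}
    (hbB : (assembly (slotsOfRecordShift D ιr cc ag sg Pm 𝒵 domZ Jc Vv mI Lsl)).SliceBudgetB W κ cB)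
    (hbA : (slotsOfRecordShift D ιr cc ag sg Pm 𝒵 domZ Jc Vv mI Lsl).D.SliceBudget (step (slotsOfRecordShift D ιr cc ag sg Pm 𝒵 domZ Jc Vv mI Lsl) E₀ cB) W κ cA)
    (hdA : DecayBound (outA (slotsOfRecordShift D ιr cc ag sg Pm 𝒵 domZ Jc Vv mI Lsl) E₀ cB) W EA₀ κ)
    (hdB : DecayBound (outB (slotsOfRecordShift D ιr cc ag sg Pm 𝒵 domZ Jc Vv mI Lsl) E₀ cB) W E₀ κ)
    (hRA : RawBounded (slotsOfRecordShift D ιr cc ag sg Pm 𝒵 domZ Jc Vv mI Lsl).F (assembly (slotsOfRecordShift D ιr cc ag sg Pm 𝒵 domZ Jc Vv mI Lsl)).rawAt W)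
    (hRB : RawBounded (slotsOfRecordShift D ιr cc ag sg Pm 𝒵 domZ Jc Vv mI Lsl).F (slotsOfRecordShift D ιr cc ag sg Pm 𝒵 domZ Jc Vv mI Lsl).rawB W)
    (hfl : ∀ k, r₀ ≤ Lsl.rOp k)
    (hins : (step (slotsOfRecordShift D ιr cc ag sg Pm 𝒵 domZ Jc Vv mI Lsl) E₀ cB).InsertionRate W κ E₀ δ' (Real.sqrt (max θ ((L : ℝ)⁻¹))))
    (hOp : ∀ k, Lsl.rOp k ≤ ROp k) (hroom : ∀ k, ROp k < R' k)
    (hHist : ∀ k, (assembly (slotsOfRecordShift D ιr cc ag sg Pm 𝒵 domZ Jc Vv mI Lsl)).bHist E₀ cB k + Lsl.rHist k ≤ RHist k)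
    -- the FACTOR operator letters of the substrate's cores of record on the `measOp`-balls about run B's datum of record
    (hm : 0 < mstar) (hmf : ∀ Z ℓ, mstar ≤ mf Z ℓ) (hN₀ : ∀ Z ℓ, 0 ≤ N₀f Z ℓ)
    (hNf : ∀ k, ∀ g ∈ W, ∀ (U : D.carriers.BgB) (X : D.carriers.Dom), D.carriers.scale X = k →
      ∀ i, (assembly (slotsOfRecordShift D ιr cc ag sg Pm 𝒵 domZ Jc Vv mI Lsl)).𝒯.Rel k i X →
      ∀ n : Fin ((assembly (slotsOfRecordShift D ιr cc ag sg Pm 𝒵 domZ Jc Vv mI Lsl)).𝒯.len i + 1),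
      (∀ op ∈ ball (⟨opOf (slotsOfRecordShift D ιr cc ag sg Pm 𝒵 domZ Jc Vv mI Lsl).F (slotsOfRecordShift D ιr cc ag sg Pm 𝒵 domZ Jc Vv mI Lsl).rawB g U k,
          opB_mem_measOp_slotsOfRecordShift D ιr cc ag sg Pm 𝒵 domZ Jc Vv mI Lsl hbdB hmQB hmRB g U k⟩ :
            measOp T ((Tor (unitMod (D.F.P D.K)) × Fin (D.F.P D.K).d) × oc) ι' Ω 𝒴) (R' k),
        AEStronglyMeasurable ((factorCores (assembly (slotsOfRecordShift D ιr cc ag sg Pm 𝒵 domZ Jc Vv mI Lsl)).𝒯 (coresRec D Pm 𝒵 domZ Jc Vv mI Lsl) i n).N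
          (op : OpDatum _)) (factorCores (assembly (slotsOfRecordShift D ιr cc ag sg Pm 𝒵 domZ Jc Vv mI Lsl)).𝒯 (coresRec D Pm 𝒵 domZ Jc Vv mI Lsl) i n).lam) ∧
      (∀ p, DifferentiableOn ℂ (fun op : measOp T ((Tor (unitMod (D.F.P D.K)) × Fin (D.F.P D.K).d) × oc) ι' Ω 𝒴 =>
          (factorCores (assembly (slotsOfRecordShift D ιr cc ag sg Pm 𝒵 domZ Jc Vv mI Lsl)).𝒯 (coresRec D Pm 𝒵 domZ Jc Vv mI Lsl) i n).N (op : OpDatum _) p)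
        (ball (⟨opOf (slotsOfRecordShift D ιr cc ag sg Pm 𝒵 domZ Jc Vv mI Lsl).F (slotsOfRecordShift D ιr cc ag sg Pm 𝒵 domZ Jc Vv mI Lsl).rawB g U k,
          opB_mem_measOp_slotsOfRecordShift D ιr cc ag sg Pm 𝒵 domZ Jc Vv mI Lsl hbdB hmQB hmRB g U k⟩ :
            measOp T ((Tor (unitMod (D.F.P D.K)) × Fin (D.F.P D.K).d) × oc) ι' Ω 𝒴) (R' k))) ∧
      (∀ op ∈ ball (⟨opOf (slotsOfRecordShift D ιr cc ag sg Pm 𝒵 domZ Jc Vv mI Lsl).F (slotsOfRecordShift D ιr cc ag sg Pm 𝒵 domZ Jc Vv mI Lsl).rawB g U k,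
          opB_mem_measOp_slotsOfRecordShift D ιr cc ag sg Pm 𝒵 domZ Jc Vv mI Lsl hbdB hmQB hmRB g U k⟩ :
            measOp T ((Tor (unitMod (D.F.P D.K)) × Fin (D.F.P D.K).d) × oc) ι' Ω 𝒴) (R' k), ∀ p,
        ‖(factorCores (assembly (slotsOfRecordShift D ιr cc ag sg Pm 𝒵 domZ Jc Vv mI Lsl)).𝒯 (coresRec D Pm 𝒵 domZ Jc Vv mI Lsl) i n).N (op : OpDatum _) p‖ ≤
          N₀f ((assembly (slotsOfRecordShift D ιr cc ag sg Pm 𝒵 domZ Jc Vv mI Lsl)).𝒯.poly i n)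
            ((assembly (slotsOfRecordShift D ιr cc ag sg Pm 𝒵 domZ Jc Vv mI Lsl)).𝒯.lab i n)))
    (hqf : ∀ k, ∀ g ∈ W, ∀ (U : D.carriers.BgB) (X : D.carriers.Dom), D.carriers.scale X = k →
      ∀ i, (assembly (slotsOfRecordShift D ιr cc ag sg Pm 𝒵 domZ Jc Vv mI Lsl)).𝒯.Rel k i X →
      ∀ n : Fin ((assembly (slotsOfRecordShift D ιr cc ag sg Pm 𝒵 domZ Jc Vv mI Lsl)).𝒯.len i + 1),
      (∀ op ∈ ball (⟨opOf (slotsOfRecordShift D ιr cc ag sg Pm 𝒵 domZ Jc Vv mI Lsl).F (slotsOfRecordShift D ιr cc ag sg Pm 𝒵 domZ Jc Vv mI Lsl).rawB g U k,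
          opB_mem_measOp_slotsOfRecordShift D ιr cc ag sg Pm 𝒵 domZ Jc Vv mI Lsl hbdB hmQB hmRB g U k⟩ :
            measOp T ((Tor (unitMod (D.F.P D.K)) × Fin (D.F.P D.K).d) × oc) ι' Ω 𝒴) (R' k),
        AEStronglyMeasurable (Function.uncurry
          ((factorCores (assembly (slotsOfRecordShift D ιr cc ag sg Pm 𝒵 domZ Jc Vv mI Lsl)).𝒯 (coresRec D Pm 𝒵 domZ Jc Vv mI Lsl) i n).q (op : OpDatum _)))
          ((factorCores (assembly (slotsOfRecordShift D ιr cc ag sg Pm 𝒵 domZ Jc Vv mI Lsl)).𝒯 (coresRec D Pm 𝒵 domZ Jc Vv mI Lsl) i n).lam.prod volume)) ∧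
      (∀ p v, DifferentiableOn ℂ (fun op : measOp T ((Tor (unitMod (D.F.P D.K)) × Fin (D.F.P D.K).d) × oc) ι' Ω 𝒴 =>
          (factorCores (assembly (slotsOfRecordShift D ιr cc ag sg Pm 𝒵 domZ Jc Vv mI Lsl)).𝒯 (coresRec D Pm 𝒵 domZ Jc Vv mI Lsl) i n).q (op : OpDatum _) p v)
        (ball (⟨opOf (slotsOfRecordShift D ιr cc ag sg Pm 𝒵 domZ Jc Vv mI Lsl).F (slotsOfRecordShift D ιr cc ag sg Pm 𝒵 domZ Jc Vv mI Lsl).rawB g U k,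
          opB_mem_measOp_slotsOfRecordShift D ιr cc ag sg Pm 𝒵 domZ Jc Vv mI Lsl hbdB hmQB hmRB g U k⟩ :
            measOp T ((Tor (unitMod (D.F.P D.K)) × Fin (D.F.P D.K).d) × oc) ι' Ω 𝒴) (R' k))) ∧
      (∀ op ∈ ball (⟨opOf (slotsOfRecordShift D ιr cc ag sg Pm 𝒵 domZ Jc Vv mI Lsl).F (slotsOfRecordShift D ιr cc ag sg Pm 𝒵 domZ Jc Vv mI Lsl).rawB g U k,
          opB_mem_measOp_slotsOfRecordShift D ιr cc ag sg Pm 𝒵 domZ Jc Vv mI Lsl hbdB hmQB hmRB g U k⟩ :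
            measOp T ((Tor (unitMod (D.F.P D.K)) × Fin (D.F.P D.K).d) × oc) ι' Ω 𝒴) (R' k), ∀ p v,
        mf ((assembly (slotsOfRecordShift D ιr cc ag sg Pm 𝒵 domZ Jc Vv mI Lsl)).𝒯.poly i n) ((assembly (slotsOfRecordShift D ιr cc ag sg Pm 𝒵 domZ Jc Vv mI Lsl)).𝒯.lab i n) *
            ‖v‖ ^ 2 -
          bf ((assembly (slotsOfRecordShift D ιr cc ag sg Pm 𝒵 domZ Jc Vv mI Lsl)).𝒯.poly i n) ((assembly (slotsOfRecordShift D ιr cc ag sg Pm 𝒵 domZ Jc Vv mI Lsl)).𝒯.lab i n) ≤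
          ((factorCores (assembly (slotsOfRecordShift D ιr cc ag sg Pm 𝒵 domZ Jc Vv mI Lsl)).𝒯 (coresRec D Pm 𝒵 domZ Jc Vv mI Lsl) i n).q (op : OpDatum _) p v).re))
    (hH : ∀ k, ∀ g ∈ W, ∀ U : D.carriers.BgB, ‖(assembly (slotsOfRecordShift D ιr cc ag sg Pm 𝒵 domZ Jc Vv mI Lsl)).histRef g U k‖ + RHist k ≤ H k)
    -- the stripped majorant's decay split and anchored exponential norm
    (hκ : 0 ≤ κ) (hA0' : ∀ k Z ℓ, 0 ≤ A' k Z ℓ)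
    (hdecM : ∀ k Z ℓ, factorMass (coresRec D Pm 𝒵 domZ Jc Vv mI Lsl) N₀f bf mstar (H k) Z ℓ ≤ A' k Z ℓ * Real.exp (-(κ * (D.carriers.d Z + 5))))
    (hΦ0 : 0 ≤ Φ') (hsmallΦ : 36 * Φ' < 1)
    (hΦ' : ∀ (k : ℕ) (q : SCube D.toTwoRuns), ∑ Z ∈ D.toTwoRuns.domAt k,
      ind (q ∈ footprint Z) * actSum (b13InnerData D.toTwoRuns) (A' k) k Z * Real.exp ((footprint Z).card) ≤ Φ')
    -- sizes, the prescribed rate, the two strict size inequalities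
    (hE₀ : 0 ≤ E₀) (hcA : 0 ≤ cA) (hcB : 0 ≤ cB) (hr₀ : 0 < r₀) (hδ' : 0 ≤ δ')
    (hθθ' : Real.sqrt (max θ ((L : ℝ)⁻¹)) ≤ θ') (hθ'1 : θ' ≤ 1) (hω : 0 < Lsl.ins.ω) (hω1 : Lsl.ins.ω < 1)
    (hh : cA * (EA₀ + E₀) < 1 - Lsl.ins.ω)
    (hsmall : Lsl.ins.ω + Φ' / (1 - 36 * Φ') * cA * (1 - Lsl.ins.ω) / (1 - Lsl.ins.ω - cA * (EA₀ + E₀)) < θ') :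
    ∃ C₅, NE5 (outA (slotsOfRecordShift D ιr cc ag sg Pm 𝒵 domZ Jc Vv mI Lsl) E₀ cB)
      (outB (slotsOfRecordShift D ιr cc ag sg Pm 𝒵 domZ Jc Vv mI Lsl) E₀ cB) W κ θ' C₅ :=
  exists_ne5_substrateShift_cores_actNorm D ιr cc ag sg Pm 𝒵 domZ Jc Vv mI Lsl hbdA hmQA hmRA hbdB hmQB hmRB iopAt hiopA E₀ cB
    hbB hbA hdA hdB hRA hRB
    (weightedEntrywiseRate_slotsOfRecordShift_balaban_rate D ιr cc ag sg Pm 𝒵 domZ Jc Vv mI Lsl L M a ha hL hd hreg hα hβ hC hθ0 hθ1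
      hloc hRp ha' hαη hβη
      hη hdec hcovA hcovB hdom₁ hΦ hΛ₂ hS₂ hdecΦ hΔA hΔB hdom₂ hΨ hΛ₃ hS₃ hdecΨ hΓA hΓB hdom₃ hΛ₄ hΛ₅ hQ hR)
    hfl hins hOp hroom hHist hm hmf hN₀ hNf hqf hH hκ hA0' hdecM hΦ0 hsmallΦ hΦ' hE₀ hcA hcB (c1_balaban_nonneg L a hC hΛ₄ hΛ₅) hr₀ hδ'
    (sqrt_rate_pos_lt_one L hL hθ1).1 (sqrt_rate_pos_lt_one L hL hθ1).2 hθθ' hθ'1 hω hω1 hh hsmall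

end Instance

end Summit.QuantumFields.BalabanUV.T4Continuum.B13AssemblyCoresEndSubstrateShiftBalabanRate

end
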